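import Mathlib
import Literature.Combinatorics.Enumerative.EntropyBregmanOrderAverage

/-!
# Stub `stub_orderAverage` (crux stmt-MatrixMultiplication-8303, line bregman-entropy-window)

Crux `Summit.MatrixMultiplication.MatrixMultiplication.Theses.SnSubsetDichotomy.GlobalBranch`, line
`bregman-entropy-window` (lead's skeleton `Cruxes/GlobalBranch/Lines/bregman_entropy_window.lean`),
registered stub `stub_orderAverage` (stub B): the **random-order average** in the entropy proof of
Brégman's theorem (Radhakrishnan 1997; Cuckler–Kahn 2009).  Rows `i' : Fin n` are revealed in a
uniformly random order `τ` (`τ k` = the row revealed at time `k`, so row `i'` is not revealed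
before row `i` iff `τ⁻¹ i ≤ τ⁻¹ i'`); for a probability vector `w` on `Fin n` (the marginal of row
`i`, `w i > 0`), `∑_{i' : τ⁻¹ i ≤ τ⁻¹ i'} w i'` is the mass still available to row `i` when it is
revealed, and

  `∑_τ log (∑_{i' : τ⁻¹ i ≤ τ⁻¹ i'} w i') ≤ (n-1)! · ∑_{k < n} log (w i + (1 - w i) · k/(n-1))`.

In the line it is combined with stub A (`stub_logIntegralBound`, the Riemann-sum estimate of the
right-hand side) inside the lead's `entropyBregman`.

The proof is the tree theorem `Literature.Combinatorics.Enumerative.sum_perm_log_avail_symm_le`: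
group the orders by the time `p = τ⁻¹ i` (`(n-1)!` each), Jensen for the concave `log` inside a
group, and the exact class average `w i + (1 - w i)(n-1-p)/(n-1)` of the available mass (a row
`i' ≠ i` comes after time `p` in exactly `(n-1-p)(n-2)!` of these orders); reindex `k = n-1-p`.
-/

set_option linter.dupNamespace false

namespace Summit.MatrixMultiplication.MatrixMultiplication.Theorems.GlobalBranch

open scoped BigOperators Classical

/-- **Stub `stub_orderAverage` — the random-order average.**  For every `n`, every probability
vector `w` on `Fin n` (`w ≥ 0`, `∑ w = 1`) and every `i` with `w i > 0`:
`∑_τ log (∑_{i' : τ⁻¹ i ≤ τ⁻¹ i'} w i') ≤ (n-1)! · ∑_{k < n} log (w i + (1 - w i) · k/(n-1))`,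
the sum over all `n!` orders `τ ∈ S_n` (position of `i` uniform, Jensen for `log` in each
position class, exact class average;
`Literature.Combinatorics.Enumerative.sum_perm_log_avail_symm_le`).
[cite: Radhakrishnan1997, proof of Thm 1] -/
theorem stub_orderAverage : ∀ (n : ℕ) (w : Fin n → ℝ) (i : Fin n), (∀ i', 0 ≤ w i') →
    ∑ i', w i' = 1 → 0 < w i →
      ∑ τ : Equiv.Perm (Fin n),
          Real.log (∑ i' ∈ Finset.univ.filter (fun i' => τ.symm i ≤ τ.symm i'), w i') ≤
        ((n - 1).factorial : ℝ) *
          ∑ k ∈ Finset.range n, Real.log (w i + (1 - w i) * ((k : ℝ) / ((n : ℝ) - 1))) :=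
  fun n w i hw0 hw1 hwi =>
    Literature.Combinatorics.Enumerative.sum_perm_log_avail_symm_le n w i hw0 hw1 hwi

end Summit.MatrixMultiplication.MatrixMultiplication.Theorems.GlobalBranch
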